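import Summits.QuantumFields.YangMills.Theorems.VirialFluxGapAssemblyScale
import HarnessLib

/-!
# Route `VirialFluxGap` ∕ the (P) road to ⟨24196⟩: ASSEMBLY OF THE PATCHED EULER FIELD, PART II♯ — the δ-SHARP DIVERGENCE BUDGET, CROSS RATE and
# SCALE PACKAGE (δ-rerun S4 of ✓`PatchingBudget.div_budget` ∕ ✓`cross_rate_le` ∕ ✓`scale_package`; LEAD sfw-p2 g97 allocation ➊)

* ★ `div_budget_sharp` — with `ψ, χ ∈ [0,1]`, `ψ′ ≤ 0`, `t₀ > 0`, a COMMON bound `B′ ≥ 0` for `div c¹` (where `ψχ ≠ 0`) and `div c²` (where `ψ(1−χ) ≠ 0`),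
  a cross term `≤ η` (`η ≥ 0`, where `ψ ≠ 0`) and the two signed drives: `ψ(χ·div c¹ + (1−χ)·div c² + cross) + (ψ′/t₀)(…) ≤ B′ + η`;
* ★ `cross_rate_le_eta` — ✓`cross_rate_le` (whose bound is `20s`) with `s ≤ δ/80`, `s ≤ 1`: the rate is `≤ δ/4`;
* ★★ `scale_package_sharp` — ✓`scale_package` with the generic drive loss `ε = (E·L⁴)⁻¹`, `400 ≤ E ≤ A`, and `80/δ ≤ A` (`0 < δ`): `t₀ = s²⁰ ≤ δ²·t_G`
  (the `η²`-window of ✓`fix_generic_divergence_upper_window_six` at `η = δ`) and the cross-term rate `≤ δ/4`; `0 < t₀ ≤ t_C` and the window identity unchanged.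

HONEST LABEL: real arithmetic; no field is built here; nothing about ⟨24196⟩ ∕ ⟨24194⟩ ∕ ⟨24197⟩ (OPEN) is proved; item of record ⟨24085⟩ SubOctaveBounded aside ∕
untouched; the Yang–Mills mass gap is NOT proved; no summit is proved by a line.  THEOREMS ONLY (0 `def`, 0 `sorry`), standard axioms.  Seat ym-line-fcl-p3 g47
(cell ym-idea-1, free hands), `--supports stmt-QuantumFields-24196`.  References: [folklore].
-/

set_option autoImplicit false

noncomputable section

open scoped BigOperators
open Literature.MathematicalPhysics.QuantumFieldTheory hiding SU2
open Literature.MathematicalPhysics.QuantumLattice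

namespace Summit.QuantumFields.YangMills.Theorems.VirialFluxGap.PatchingBudget

open Summit.QuantumFields.YangMills.Theorems.FemtoTransferGap
open Summit.QuantumFields.YangMills.Theorems.VirialFluxGap.FixFrame

variable {L : ℕ} [NeZero L]

/-- ★ **Divergence budget, δ-sharp**: common bound `B′ ≥ 0` for the two pieces (each only where its cutoff product is non-zero), cross `≤ η` where `ψ ≠ 0`,
signed `ψ′`-term ⟹ total `≤ B′ + η`. [folklore] -/
theorem div_budget_sharp {ψv χv θv dψ t₀ B' η D₁ D₂ X d₁ d₂ : ℝ}
    (hψ0 : 0 ≤ ψv) (hψ1 : ψv ≤ 1) (hχ0 : 0 ≤ χv) (hχ1 : χv ≤ 1) (hdψ : dψ ≤ 0) (ht₀ : 0 < t₀) (hB : 0 ≤ B') (hη : 0 ≤ η)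
    (h3 : ψv ≠ 0 → χv ≠ 0 → D₁ ≤ B') (h4 : ψv ≠ 0 → χv ≠ 1 → D₂ ≤ B') (h5 : ψv ≠ 0 → X ≤ η)
    (h1 : dψ ≠ 0 → χv ≠ 0 → θv = 1 ∧ 0 ≤ d₁) (h2 : dψ ≠ 0 → χv ≠ 1 → 0 ≤ d₂) :
    ψv * (χv * D₁ + (1 - χv) * D₂ + X) + dψ / t₀ * (χv * (θv * d₁) + (1 - χv) * d₂) ≤ B' + η := by
  have hT : dψ / t₀ * (χv * (θv * d₁) + (1 - χv) * d₂) ≤ 0 := by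
    by_cases hd : dψ = 0
    · rw [hd, zero_div, zero_mul]
    · have hin : 0 ≤ χv * (θv * d₁) + (1 - χv) * d₂ := by
        refine add_nonneg ?_ ?_
        · by_cases hχ : χv = 0
          · rw [hχ, zero_mul]
          · obtain ⟨hθ, hd1⟩ := h1 hd hχ
            rw [hθ, one_mul]; exact mul_nonneg hχ0 hd1
        · by_cases hχ : χv = 1
          · rw [hχ, sub_self, zero_mul]
          · exact mul_nonneg (by linarith) (h2 hd hχ)
      exact mul_nonpos_of_nonpos_of_nonneg (div_nonpos_of_nonpos_of_nonneg hdψ ht₀.le) hin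
  have hS : ψv * (χv * D₁ + (1 - χv) * D₂ + X) ≤ B' + η := by
    by_cases hψ : ψv = 0
    · rw [hψ, zero_mul]; linarith
    · have hA : χv * D₁ ≤ χv * B' := by
        by_cases hχ : χv = 0
        · rw [hχ, zero_mul, zero_mul]
        · exact mul_le_mul_of_nonneg_left (h3 hψ hχ) hχ0
      have hB2 : (1 - χv) * D₂ ≤ (1 - χv) * B' := by
        by_cases hχ : χv = 1
        · rw [hχ, sub_self, zero_mul, zero_mul]
        · exact mul_le_mul_of_nonneg_left (h4 hψ hχ) (by linarith)
      have hX := h5 hψ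
      have hin : χv * D₁ + (1 - χv) * D₂ + X ≤ B' + η := by nlinarith
      calc ψv * (χv * D₁ + (1 - χv) * D₂ + X) ≤ ψv * (B' + η) := mul_le_mul_of_nonneg_left hin hψ0
        _ ≤ 1 * (B' + η) := mul_le_mul_of_nonneg_right hψ1 (by linarith)
        _ = B' + η := one_mul _
  linarith

/-- ★ **The cross-term rate at target `δ/4`**: ✓`cross_rate_le`'s bound is `20s`; with `s ≤ δ/80` (and `s ≤ 1`) it is `≤ δ/4`. [folklore] -/
theorem cross_rate_le_eta {s D ρ AG N δ : ℝ} (hs0 : 0 < s) (hs1 : s ≤ 1) (hsδ : s ≤ δ / 80) (hD0 : 0 ≤ D) (hD : D ≤ s⁻¹) (hρ : s ≤ ρ ^ 2)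
    (hAG0 : 0 ≤ AG) (hAG : AG ≤ 4 * (s ^ 7)⁻¹) (hN0 : 0 ≤ N) (hN : N ≤ s⁻¹) :
    4 * (D / ρ ^ 2) * (AG + N) * Real.sqrt (s ^ 20) ≤ δ / 4 := by
  rw [sqrt_pow_twenty hs0.le]
  have hρ2 : 0 < ρ ^ 2 := lt_of_lt_of_le hs0 hρ
  have h1 : D / ρ ^ 2 ≤ s⁻¹ * s⁻¹ := by
    rw [div_le_iff₀ hρ2]
    have : s⁻¹ * s⁻¹ * s ≤ s⁻¹ * s⁻¹ * ρ ^ 2 := mul_le_mul_of_nonneg_left hρ (by positivity)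
    have e : s⁻¹ * s⁻¹ * s = s⁻¹ := by field_simp
    rw [e] at this
    exact hD.trans this
  have h7 : s⁻¹ ≤ (s ^ 7)⁻¹ := by
    rw [inv_le_inv₀ hs0 (by positivity)]
    calc s ^ 7 = s * s ^ 6 := by ring
      _ ≤ s * 1 := mul_le_mul_of_nonneg_left (pow_le_one₀ hs0.le hs1) hs0.le
      _ = s := mul_one _
  have h2 : AG + N ≤ 5 * (s ^ 7)⁻¹ := by linarith
  have h3 : 4 * (D / ρ ^ 2) * (AG + N) * s ^ 10 ≤ 4 * (s⁻¹ * s⁻¹) * (5 * (s ^ 7)⁻¹) * s ^ 10 := by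
    have hp : 0 ≤ s ^ 10 := by positivity
    have hq : 0 ≤ D / ρ ^ 2 := div_nonneg hD0 hρ2.le
    gcongr
  have e : 4 * (s⁻¹ * s⁻¹) * (5 * (s ^ 7)⁻¹) * s ^ 10 = 20 * s := by field_simp; ring
  rw [e] at h3
  linarith

/-- ★★ **THE SCALE PACKAGE, δ-sharp** (`ε = (E·L⁴)⁻¹`, `400 ≤ E ≤ A`, `80/δ ≤ A`, `0 < δ`; `t₀ = s²⁰ ≤ δ²·t_G` — the `η²`-window of
✓`fix_generic_divergence_upper_window_six` with `η = δ` — and the cross-term rate `≤ δ/4`).  ORIGINAL (`ε = (400L⁴)⁻¹`, `t₀ ≤ t_G`, rate `≤ 1/16`):  With `s = (A·L^a)⁻¹` and `t₀ = s²⁰`: `0 < t₀`, `t₀ ≤ t_C`, `t₀ ≤ t_G(ρ′, ε, C₃L⁴)` (the window of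
✓`fix_generic_*_window`, `ρ′ = ρ/√2`, `ε = (400L⁴)⁻¹`), the cross-term rate `4(Dψ/ρ²)(A_G + N)√t₀ ≤ 1/16` with
`A_G = √(#ι·2C₂L⁴/(λ⋆/2)²)·√(4#ι)`, and the window identity `(2A²⁰L^{20a})⁻¹ = t₀/2`. [folklore] -/
theorem scale_package_sharp {K_C : ℝ} (hK_C : 1 ≤ K_C) {q_C : ℕ} {A : ℝ} {a : ℕ} {C₃ C₂ Dψ ρ t_C N E δ : ℝ}
    (hE : 400 ≤ E) (hδ : 0 < δ) (hAE : E ≤ A) (hAδ : 80 / δ ≤ A)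
    (hC₃0 : 0 ≤ C₃) (hC₂0 : 0 ≤ C₂) (hDψ0 : 0 ≤ Dψ)
    (hA1 : 2 * K_C ^ 2 ≤ A) (hA3 : 1032960 * 10000 ≤ A) (hA4 : (C₃ + 1) ^ 2 ≤ A) (hA5 : (21 : ℝ) ^ 5 ≤ A)
    (hA7 : Dψ + 1 ≤ A) (hA8 : 2 * C₂ + 2 ≤ A) (ha1 : 2 * q_C ≤ a) (ha2 : 20 ≤ a)
    (hρlo : (K_C * (L : ℝ) ^ q_C)⁻¹ ≤ ρ) (hρhi : ρ ≤ 1 / 2) (htC : (K_C * (L : ℝ) ^ q_C)⁻¹ ≤ t_C) (hN0 : 0 ≤ N) (hN : N ≤ K_C * (L : ℝ) ^ q_C) :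
    0 < ((A * (L : ℝ) ^ a)⁻¹) ^ 20 ∧
    ((A * (L : ℝ) ^ a)⁻¹) ^ 20 ≤ t_C ∧
    ((A * (L : ℝ) ^ a)⁻¹) ^ 20 ≤ δ ^ 2 * ((ρ / Real.sqrt 2) ^ 2 * ((E * (L : ℝ) ^ 4)⁻¹) ^ 3 * ((ρ / Real.sqrt 2) ^ 2 / (1032960 * (L : ℝ) ^ 8)) ^ 2 /
          (1032960 * 10000 * (L : ℝ) ^ 8 * (C₃ * (L : ℝ) ^ 4 + 1) ^ 2 * (Fintype.card (FixVar L × Fin 3) : ℝ) ^ 5)) ∧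
    4 * (Dψ / ρ ^ 2) * (Real.sqrt ((Fintype.card (FixVar L × Fin 3) : ℝ) * (2 * (C₂ * (L : ℝ) ^ 4)) /
          (((E * (L : ℝ) ^ 4)⁻¹ * ((ρ / Real.sqrt 2) ^ 2 / (1032960 * (L : ℝ) ^ 8)) / 3) / 2) ^ 2) *
        Real.sqrt (4 * (Fintype.card (FixVar L × Fin 3) : ℝ)) + N) * Real.sqrt (((A * (L : ℝ) ^ a)⁻¹) ^ 20) ≤ δ / 4 ∧
    (2 * A ^ 20 * (L : ℝ) ^ (((20 * a : ℕ) : ℝ)))⁻¹ = ((A * (L : ℝ) ^ a)⁻¹) ^ 20 / 2 := by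
  /- reals -/
  have hL1 : (1 : ℝ) ≤ L := by exact_mod_cast NeZero.one_le
  have hL0 : (0 : ℝ) < L := by positivity
  have hA0 : 0 < A := by linarith
  have hE0 : 0 < E := by linarith
  have hA1' : 1 ≤ A := by linarith
  have hKC0 : 0 < K_C := by linarith
  have hKA : K_C ≤ A := by nlinarith only [hK_C, hA1]
  have hPpos : 0 < K_C * (L : ℝ) ^ q_C := by positivity
  have hρ0 : 0 < ρ := lt_of_lt_of_le (by positivity) hρlo
  have hρ1 : ρ ≤ 1 := by linarith
  -- the scale
  set s : ℝ := (A * (L : ℝ) ^ a)⁻¹ with hs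
  have hs0 : 0 < s := by rw [hs]; positivity
  have hsinv : s⁻¹ = A * (L : ℝ) ^ a := by rw [hs, inv_inv]
  have hsle : ∀ {A' : ℝ} {a' : ℕ}, 0 < A' → A' ≤ A → a' ≤ a → s ≤ (A' * (L : ℝ) ^ a')⁻¹ :=
    fun hA' hAA haa => inv_poly_le_inv_poly hA' hAA haa hL1
  have hles : ∀ {X A' : ℝ} {a' : ℕ}, X ≤ A' * (L : ℝ) ^ a' → 0 ≤ A' → A' ≤ A → a' ≤ a → X ≤ s⁻¹ := by
    intro X A' a' hX hA'0 hAA haa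
    rw [hsinv]
    exact hX.trans (mul_le_mul hAA (pow_le_pow_right₀ hL1 haa) (by positivity) hA0.le)
  have at320 : s ≤ 1 / 320 := by
    have h := hsle (A' := 320) (a' := 0) (by norm_num) (by linarith) (Nat.zero_le _)
    simpa using h
  have atδ : s ≤ δ / 80 := by
    have h := hsle (A' := 80 / δ) (a' := 0) (by positivity) hAδ (Nat.zero_le _)
    rw [pow_zero, mul_one, inv_div] at h
    exact h
  have atδ' : s ≤ δ := atδ.trans (by linarith)
  have hs1 : s ≤ 1 := by linarith
  have at3 : 3 * s ≤ 1 := by linarith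
  have atP : s ≤ (K_C * (L : ℝ) ^ q_C)⁻¹ := hsle hKC0 hKA (by omega)
  have atρ2 : s ≤ ρ ^ 2 / 2 := by
    have h1 : s ≤ (2 * K_C ^ 2 * (L : ℝ) ^ (2 * q_C))⁻¹ := hsle (by positivity) hA1 ha1
    have h2 : (2 * K_C ^ 2 * (L : ℝ) ^ (2 * q_C))⁻¹ = ((K_C * (L : ℝ) ^ q_C)⁻¹) ^ 2 / 2 := by
      rw [pow_mul]; field_simp; ring
    have h3 : ((K_C * (L : ℝ) ^ q_C)⁻¹) ^ 2 ≤ ρ ^ 2 := pow_le_pow_left₀ (by positivity) hρlo 2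
    rw [h2] at h1
    linarith
  have atρ : s ≤ ρ ^ 2 := atρ2.trans (by linarith [sq_nonneg ρ])
  have atε : s ≤ (E * (L : ℝ) ^ 4)⁻¹ := hsle hE0 hAE (by omega)
  have at8 : s ≤ (1032960 * (L : ℝ) ^ 8)⁻¹ := hsle (by norm_num) (by linarith) (by omega)
  have at8' : (1032960 * (L : ℝ) ^ 8) * s ≤ 1 := by
    rw [← le_div_iff₀' (by positivity), one_div]; exact at8
  have aty1 : (1032960 * 10000 * (L : ℝ) ^ 8) * s ≤ 1 := by
    rw [← le_div_iff₀' (by positivity), one_div]; exact hsle (by norm_num) hA3 (by omega)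
  have aty2 : (C₃ * (L : ℝ) ^ 4 + 1) ^ 2 * s ≤ 1 := by
    have h1 : C₃ * (L : ℝ) ^ 4 + 1 ≤ (C₃ + 1) * (L : ℝ) ^ 4 := by nlinarith only [one_le_pow₀ (n := 4) hL1, hC₃0]
    have h2 : (C₃ * (L : ℝ) ^ 4 + 1) ^ 2 ≤ (C₃ + 1) ^ 2 * (L : ℝ) ^ 8 := by
      calc (C₃ * (L : ℝ) ^ 4 + 1) ^ 2 ≤ ((C₃ + 1) * (L : ℝ) ^ 4) ^ 2 := pow_le_pow_left₀ (by positivity) h1 2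
        _ = (C₃ + 1) ^ 2 * (L : ℝ) ^ 8 := by ring
    have h3 : s ≤ ((C₃ + 1) ^ 2 * (L : ℝ) ^ 8)⁻¹ := hsle (by positivity) hA4 (by omega)
    rw [le_inv_comm₀ hs0 (by positivity)] at h3
    calc (C₃ * (L : ℝ) ^ 4 + 1) ^ 2 * s ≤ (C₃ + 1) ^ 2 * (L : ℝ) ^ 8 * s := mul_le_mul_of_nonneg_right h2 hs0.le
      _ ≤ s⁻¹ * s := mul_le_mul_of_nonneg_right h3 hs0.le
      _ = 1 := inv_mul_cancel₀ hs0.ne'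
  have hcard : (Fintype.card (FixVar L × Fin 3) : ℝ) = 18 * (L : ℝ) ^ 4 + 3 := card_fixVar_mul_three_real
  obtain ⟨hc21, hc5⟩ := card_le_pow hL1
  have aty3 : (Fintype.card (FixVar L × Fin 3) : ℝ) ^ 5 * s ≤ 1 := by
    rw [hcard]
    have h3 : s ≤ ((21 : ℝ) ^ 5 * (L : ℝ) ^ 20)⁻¹ := hsle (by positivity) hA5 ha2
    rw [le_inv_comm₀ hs0 (by positivity)] at h3
    calc (18 * (L : ℝ) ^ 4 + 3) ^ 5 * s ≤ (21 : ℝ) ^ 5 * (L : ℝ) ^ 20 * s := mul_le_mul_of_nonneg_right hc5 hs0.le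
      _ ≤ s⁻¹ * s := mul_le_mul_of_nonneg_right h3 hs0.le
      _ = 1 := inv_mul_cancel₀ hs0.ne'
  have attC : s ≤ t_C := atP.trans htC
  have atN : N ≤ s⁻¹ := hles hN hKC0.le hKA (by omega)
  have atD : Dψ ≤ s⁻¹ := hles (A' := Dψ + 1) (a' := 0) (by rw [pow_zero, mul_one]; linarith) (by linarith) hA7 (Nat.zero_le _)
  have atc : (Fintype.card (FixVar L × Fin 3) : ℝ) ≤ s⁻¹ := by
    rw [hcard]; exact hles hc21 (by norm_num) (le_trans (by norm_num) hA5) (by omega)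
  have atL4 : (L : ℝ) ^ 4 ≤ s⁻¹ := hles (A' := 1) (a' := 4) (by rw [one_mul]) zero_le_one hA1' (by omega)
  have atC2 : 2 * C₂ ≤ s⁻¹ := hles (A' := 2 * C₂ + 2) (a' := 0) (by rw [pow_zero, mul_one]; linarith) (by linarith) hA8 (Nat.zero_le _)
  /- parameters -/
  set ρ' : ℝ := ρ / Real.sqrt 2 with hρ'def
  have hρ'sq : ρ' ^ 2 = ρ ^ 2 / 2 := by
    rw [hρ'def, div_pow, Real.sq_sqrt (by norm_num)]
  set ε : ℝ := (E * (L : ℝ) ^ 4)⁻¹ with hεdef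
  have hε0 : 0 < ε := by rw [hεdef]; positivity
  have hκ : s ^ 2 ≤ ρ' ^ 2 / (1032960 * (L : ℝ) ^ 8) :=
    pow_add_le_div (m := 1) (n := 1) hs0.le (by rw [pow_one, hρ'sq]; exact atρ2) (by positivity) (by simpa using at8')
  have hlam : s ^ 4 ≤ ε * (ρ' ^ 2 / (1032960 * (L : ℝ) ^ 8)) / 3 :=
    pow_add_le_div (m := 3) (n := 1) hs0.le (pow_add_le_mul (m := 1) (n := 2) hs0.le (by rw [pow_one]; exact atε) hκ) (by norm_num)
      (by simpa [mul_comm] using at3)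
  have hlam0 : 0 < ε * (ρ' ^ 2 / (1032960 * (L : ℝ) ^ 8)) / 3 := by positivity
  /- t_G ≥ s¹¹ -/
  have htG : s ^ 11 ≤ ρ' ^ 2 * ε ^ 3 * (ρ' ^ 2 / (1032960 * (L : ℝ) ^ 8)) ^ 2 /
      (1032960 * 10000 * (L : ℝ) ^ 8 * (C₃ * (L : ℝ) ^ 4 + 1) ^ 2 * (Fintype.card (FixVar L × Fin 3) : ℝ) ^ 5) := by
    have hnum : s ^ 8 ≤ ρ' ^ 2 * ε ^ 3 * (ρ' ^ 2 / (1032960 * (L : ℝ) ^ 8)) ^ 2 := by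
      have h1 : s ^ 1 ≤ ρ' ^ 2 := by rw [pow_one, hρ'sq]; exact atρ2
      have h2 : s ^ 3 ≤ ε ^ 3 := pow_le_pow_left₀ hs0.le atε 3
      have h3 : s ^ 4 ≤ (ρ' ^ 2 / (1032960 * (L : ℝ) ^ 8)) ^ 2 := by
        rw [show s ^ 4 = (s ^ 2) ^ 2 by ring]; exact pow_le_pow_left₀ (by positivity) hκ 2
      exact pow_add_le_mul (m := 4) (n := 4) hs0.le (pow_add_le_mul (m := 1) (n := 3) hs0.le h1 h2) h3
    refine pow_add_le_div (m := 8) (n := 3) hs0.le hnum (by positivity) ?_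
    have e : 1032960 * 10000 * (L : ℝ) ^ 8 * (C₃ * (L : ℝ) ^ 4 + 1) ^ 2 * (Fintype.card (FixVar L × Fin 3) : ℝ) ^ 5 * s ^ 3 =
        ((1032960 * 10000 * (L : ℝ) ^ 8) * s) * (((C₃ * (L : ℝ) ^ 4 + 1) ^ 2) * s) * (((Fintype.card (FixVar L × Fin 3) : ℝ) ^ 5) * s) := by ring
    rw [e]
    exact mul_three_le_one aty1 (by positivity) aty2 (by positivity) aty3
  /- the cross-term rate -/
  set AG : ℝ := Real.sqrt ((Fintype.card (FixVar L × Fin 3) : ℝ) * (2 * (C₂ * (L : ℝ) ^ 4)) /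
      ((ε * (ρ' ^ 2 / (1032960 * (L : ℝ) ^ 8)) / 3) / 2) ^ 2) * Real.sqrt (4 * (Fintype.card (FixVar L × Fin 3) : ℝ)) with hAGdef
  have hAG0 : 0 ≤ AG := by rw [hAGdef]; positivity
  have hAG : AG ≤ 4 * (s ^ 7)⁻¹ := by
    have hlam8 : s ^ 8 ≤ (ε * (ρ' ^ 2 / (1032960 * (L : ℝ) ^ 8)) / 3) ^ 2 := by
      rw [show s ^ 8 = (s ^ 4) ^ 2 by ring]; exact pow_le_pow_left₀ (by positivity) hlam 2
    have hcs : (Fintype.card (FixVar L × Fin 3) : ℝ) * s ≤ 1 := by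
      have := mul_le_mul_of_nonneg_right atc hs0.le; rwa [inv_mul_cancel₀ hs0.ne'] at this
    have hC2s : 2 * C₂ * s ≤ 1 := by
      have := mul_le_mul_of_nonneg_right atC2 hs0.le; rwa [inv_mul_cancel₀ hs0.ne'] at this
    have hL4s : (L : ℝ) ^ 4 * s ≤ 1 := by
      have := mul_le_mul_of_nonneg_right atL4 hs0.le; rwa [inv_mul_cancel₀ hs0.ne'] at this
    have hsq : AG ^ 2 = ((Fintype.card (FixVar L × Fin 3) : ℝ) * (2 * (C₂ * (L : ℝ) ^ 4)) /
        ((ε * (ρ' ^ 2 / (1032960 * (L : ℝ) ^ 8)) / 3) / 2) ^ 2) * (4 * (Fintype.card (FixVar L × Fin 3) : ℝ)) := by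
      rw [hAGdef, mul_pow, Real.sq_sqrt (by positivity), Real.sq_sqrt (by positivity)]
    have hkey : AG ^ 2 * s ^ 14 ≤ 16 := by
      rw [hsq]
      have hden : 0 < ((ε * (ρ' ^ 2 / (1032960 * (L : ℝ) ^ 8)) / 3) / 2) ^ 2 := by positivity
      rw [div_mul_eq_mul_div, div_mul_eq_mul_div, div_le_iff₀ hden]
      have e : (Fintype.card (FixVar L × Fin 3) : ℝ) * (2 * (C₂ * (L : ℝ) ^ 4)) * (4 * (Fintype.card (FixVar L × Fin 3) : ℝ)) * s ^ 14 =
          4 * ((((Fintype.card (FixVar L × Fin 3) : ℝ) * s) * ((Fintype.card (FixVar L × Fin 3) : ℝ) * s)) * ((2 * C₂ * s) * ((L : ℝ) ^ 4 * s))) * s ^ 10 := by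
        ring
      have hp1 : ((Fintype.card (FixVar L × Fin 3) : ℝ) * s) * ((Fintype.card (FixVar L × Fin 3) : ℝ) * s) ≤ 1 :=
        mul_le_one₀ hcs (by positivity) hcs
      have hp2 : (2 * C₂ * s) * ((L : ℝ) ^ 4 * s) ≤ 1 := mul_le_one₀ hC2s (by positivity) hL4s
      have hp : (((Fintype.card (FixVar L × Fin 3) : ℝ) * s) * ((Fintype.card (FixVar L × Fin 3) : ℝ) * s)) * ((2 * C₂ * s) * ((L : ℝ) ^ 4 * s)) ≤ 1 :=
        mul_le_one₀ hp1 (by positivity) hp2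
      have hs10 : s ^ 10 ≤ s ^ 8 := pow_le_pow_of_le_one hs0.le hs1 (by norm_num)
      have hs10' : 0 ≤ s ^ 10 := by positivity
      calc (Fintype.card (FixVar L × Fin 3) : ℝ) * (2 * (C₂ * (L : ℝ) ^ 4)) * (4 * (Fintype.card (FixVar L × Fin 3) : ℝ)) * s ^ 14
          = 4 * ((((Fintype.card (FixVar L × Fin 3) : ℝ) * s) * ((Fintype.card (FixVar L × Fin 3) : ℝ) * s)) * ((2 * C₂ * s) * ((L : ℝ) ^ 4 * s))) * s ^ 10 := e
        _ ≤ 4 * 1 * s ^ 10 := mul_le_mul_of_nonneg_right (mul_le_mul_of_nonneg_left hp (by norm_num)) hs10'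
        _ ≤ 4 * 1 * s ^ 8 := mul_le_mul_of_nonneg_left hs10 (by norm_num)
        _ ≤ 4 * (ε * (ρ' ^ 2 / (1032960 * (L : ℝ) ^ 8)) / 3) ^ 2 := by linarith only [hlam8]
        _ = 16 * ((ε * (ρ' ^ 2 / (1032960 * (L : ℝ) ^ 8)) / 3) / 2) ^ 2 := by ring
    have htarget : (4 * (s ^ 7)⁻¹) ^ 2 * s ^ 14 = 16 := by field_simp; ring
    have h0 : 0 ≤ 4 * (s ^ 7)⁻¹ := by positivity
    by_contra hcon
    rw [not_le] at hcon
    have h1 : (4 * (s ^ 7)⁻¹) ^ 2 < AG ^ 2 := by gcongr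
    have h2 : (4 * (s ^ 7)⁻¹) ^ 2 * s ^ 14 < AG ^ 2 * s ^ 14 := mul_lt_mul_of_pos_right h1 (by positivity)
    linarith only [h2, hkey, htarget]
  have hcross : 4 * (Dψ / ρ ^ 2) * (AG + N) * Real.sqrt (s ^ 20) ≤ δ / 4 :=
    cross_rate_le_eta hs0 hs1 atδ hDψ0 atD atρ hAG0 hAG hN0 atN
  /- conclusion -/
  have hη2 : s ^ 9 ≤ δ ^ 2 := by
    have h9 : s ^ 9 ≤ s ^ 2 := pow_le_pow_of_le_one hs0.le hs1 (by norm_num)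
    exact h9.trans (pow_le_pow_left₀ hs0.le atδ' 2)
  have h20 : s ^ 20 ≤ δ ^ 2 * (ρ' ^ 2 * ε ^ 3 * (ρ' ^ 2 / (1032960 * (L : ℝ) ^ 8)) ^ 2 /
      (1032960 * 10000 * (L : ℝ) ^ 8 * (C₃ * (L : ℝ) ^ 4 + 1) ^ 2 * (Fintype.card (FixVar L × Fin 3) : ℝ) ^ 5)) := by
    rw [show s ^ 20 = s ^ 9 * s ^ 11 by ring]
    exact mul_le_mul hη2 htG (by positivity) (by positivity)
  refine ⟨by positivity, (pow_le_of_le_one hs0.le hs1 (by norm_num)).trans attC, h20, hcross, ?_⟩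
  rw [hs]; exact half_window_eq hA0 hL0

end Summit.QuantumFields.YangMills.Theorems.VirialFluxGap.PatchingBudget

end
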